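import Mathlib
import Summits.NavierStokesRegularity.NavierStokesRegularity.Theorems.EulerZoomLiouvillePowerGaugeEulerLiouvilleSelfSimilarPastSubExtremal
import Summits.NavierStokesRegularity.NavierStokesRegularity.Theorems.EulerZoomLiouvillePowerGaugeEulerLiouvilleSelfSimilarPastProfileGradient
import Summits.NavierStokesRegularity.NavierStokesRegularity.Theorems.EulerZoomLiouvillePowerGaugeEulerLiouvilleKillingRotation
import HarnessLib

/-!
# Crux `EulerZoomLiouville.PowerGaugeEulerLiouville` (stmt-NavierStokesRegularity-19832), line `relative_equilibria` (ns-idea-11):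
# THE RADIAL ENDGAME OF THE SUB-EXTREMAL SPIRAL STRATUM (R3 from R3a, member level, `S`-free part)

Route `EulerZoomLiouville` (NavierStokesRegularity), crux E; LEAD ns-typeII-p2 g17 (brick R3a-END of the R3a wave keyed
2026-08-29T14:00Z; the bricks P2–P7 of the port recipe `Cruxes/PowerGaugeEulerLiouville/Lines/relative-equilibria.md` and their
assembly are the hands').  Theorems-side port, VERBATIM up to unfolding the line file's reducible predicates, of the kernel-checked
section `SpiralEndgame` of `Cruxes/PowerGaugeEulerLiouville/Lines/relative_equilibria.lean` (commit 250c6f9066fe, ns-idea-11 g11/g12):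

* `Spiral.hasRadialGradient_of_inner`, `Spiral.hasRadialGradient_comp_inv_smul` — radial gradients (`∇θ(z) ∥ z`, the line's
  `HasRadialGradient θ` unfolded as `∀ z, ∃ m, gradient θ z = m • z`) from the `k`-clause of `EnergySaturation.exists_radialCutoff`
  and under rescaling;
* `Spiral.ae_eq_zero_of_subExtremal_loc_radial` — the tree's Bronzi–Shvydkoy large-scale sub-extremal dichotomy
  `EnergySaturation.ae_eq_zero_of_subExtremal_loc` with the profile local energy identity asked ONLY for radial-gradient tests (the
  proof consumes it only through the rescaled radial cut-offs `σ(L⁻¹·)`): profile data `(V, P, G, c)` in the shapes (A₁)/(E₁)/(D₁)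
  for `L ≥ 1`, weak pressure Poisson, RADIAL local energy identity, `liminf_{L→∞} L^{2ρ−1}∫_{B_L}|V|² = 0` ⇒ `V = 0` a.e.;
* `Spiral.ae_eq_zero_of_profile_ae_eq_zero_pastSpiral` — a Perelman-spiral member
  `u(τ,x) = (T−τ)^{γ−1} e^{(log(T−τ))S} V(e^{−(log(T−τ))S}(T−τ)^{−γ}(x−x₀))` (`τ < T₁ ≤ T`, `S` skew, `γ = 1/(2+ρ)`) whose profile
  vanishes a.e. is trivial (null sets pull back along the slice maps: `Killing.measurePreserving_expSkew`,
  `Past.quasiMeasurePreserving_smul_sub`; then the filled stratum `ae_eq_zero_of_gauge_of_energyVanishing_allRho`);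
* `Spiral.pastSpiral_trivial_of_locData_of_subExtremal` — THE SUB-EXTREMAL SPIRAL MEMBER IS TRIVIAL MODULO THE SPIRAL DICTIONARY:
  hypothesis = the conclusion of the line's R3a `Sig.stub_spiralLocData` verbatim (`HasRadialGradient` unfolded); composing with the
  dictionary (bricks P2–P7, separate files) gives the LEAD's binder `¬ IsPastSpiralSubExtremal ρ u` of `stub_nonSelfSimilarRest`.

For `S = 0` these are the tree's `Past.selfSimilar_ae_eq_zero_of_subExtremal_past` chain.  WHAT THIS IS NOT: not NS, not E, not a
stub of the skeleton of record — `--supports` stmt-19832 (Theorems-side plumbing of a width sub-line; 19832 OPEN).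
[folklore; cf. BronziShvydkoy2015 Thm 1.1]
-/

noncomputable section

-- flat `Theorems/<Route><Decl>…` files of one crux share the namespace of the crux (tree convention: `Summit.<S>.<S>.…`)
set_option linter.dupNamespace false

open MeasureTheory Set Filter Topology Metric Real Function TopologicalSpace
open scoped ENNReal NNReal RealInnerProductSpace ContDiff Laplacian InnerProductSpace

namespace Summit.NavierStokesRegularity.NavierStokesRegularity.Theorems.PowerGaugeEulerLiouville

open Literature.Analysis Literature.Analysis.FluidPDE Literature.Analysis.FunctionSpaces
open Summit.NavierStokesRegularity.NavierStokesRegularity.Theorems.PowerGaugeEulerLiouville.EnergySaturation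

namespace Spiral

/-- A gradient given by `⟪w, ∇σ(z)⟫ = −k(z)⟪w, z⟫` (the `k`-clause of `EnergySaturation.exists_radialCutoff`) is RADIAL:
`∇σ(z) = (−k z) • z`. -/
theorem hasRadialGradient_of_inner {σ : EuclideanSpace ℝ (Fin 3) → ℝ} {k : EuclideanSpace ℝ (Fin 3) → ℝ}
    (hk : ∀ z w : EuclideanSpace ℝ (Fin 3), ⟪w, gradient σ z⟫ = -(k z * ⟪w, z⟫)) :
    ∀ z : EuclideanSpace ℝ (Fin 3), ∃ m : ℝ, gradient σ z = m • z := by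
  intro z
  refine ⟨-k z, ext_inner_left ℝ fun w => ?_⟩
  rw [hk z w, real_inner_smul_right]
  ring

/-- Rescaling preserves radial gradients: `∇(σ(L⁻¹·))(z) = L⁻¹∇σ(L⁻¹z) ∥ z`. -/
theorem hasRadialGradient_comp_inv_smul {σ : EuclideanSpace ℝ (Fin 3) → ℝ} (hσ : Differentiable ℝ σ) (hrad : ∀ z : EuclideanSpace ℝ (Fin 3), ∃ m : ℝ, gradient σ z = m • z) (L : ℝ) :
    ∀ z : EuclideanSpace ℝ (Fin 3), ∃ m : ℝ, gradient (fun z => σ (L⁻¹ • z)) z = m • z := by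
  intro z
  obtain ⟨m, hm⟩ := hrad (L⁻¹ • z)
  refine ⟨L⁻¹ * m * L⁻¹, ?_⟩
  rw [gradient_comp_inv_smul hσ L z, hm, smul_smul, smul_smul]

/-- **The large-scale sub-extremal dichotomy with the local energy identity asked ONLY for radial-gradient tests** — the tree's
`EnergySaturation.ae_eq_zero_of_subExtremal_loc` verbatim with `hEE` weakened to `HasRadialGradient θ →`: the proof uses the
identity only for the rescaled radial cut-offs `σ(L⁻¹·)`.  Profile data `(V, P, G, c)` in the shapes (A₁), (E₁), (D₁) for `L ≥ 1`,
weak pressure Poisson equation, radial local energy identity, and `liminf_{L→∞} L^{2ρ−1}∫_{B_L}|V|² = 0` ⇒ `V = 0` a.e.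
(`0 < ρ < 1`). [folklore; cf. BronziShvydkoy2015 Thm 1.1] -/
theorem ae_eq_zero_of_subExtremal_loc_radial {ρ : ℝ} (hρ : 0 < ρ) (hρ1 : ρ < 1)
    {V : EuclideanSpace ℝ (Fin 3) → EuclideanSpace ℝ (Fin 3)} {P : EuclideanSpace ℝ (Fin 3) → ℝ} {G : EuclideanSpace ℝ (Fin 3) → EuclideanSpace ℝ (Fin 3) →L[ℝ] EuclideanSpace ℝ (Fin 3)}
    (hVm : AEStronglyMeasurable V volume) (hPm : AEStronglyMeasurable P volume)
    (hGm : AEStronglyMeasurable G volume)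
    (hVG : HasWeakFDerivOn (⊤ : Opens (EuclideanSpace ℝ (Fin 3))) volume V G) {c : ℝ≥0}
    (hA : ∀ L : ℝ, 1 ≤ L → ∫⁻ y in ball (0 : EuclideanSpace ℝ (Fin 3)) L, ‖V y‖ₑ ^ 2 ≤
      (c : ℝ≥0∞) * ENNReal.ofReal (L ^ (1 - 2 * ρ)))
    (hE : ∀ L : ℝ, 1 ≤ L →
      ∫⁻ y in ball (0 : EuclideanSpace ℝ (Fin 3)) L, ENNReal.ofReal (frobeniusNormSq (G y)) ≤
        ENNReal.ofReal (L ^ (1 - ρ)) * (ENNReal.ofReal ((1 - ρ) / (2 + ρ)) * (c : ℝ≥0∞)))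
    (hD : ∀ L : ℝ, 1 ≤ L →
      ∫⁻ y in ball (0 : EuclideanSpace ℝ (Fin 3)) L, ‖P y‖ₑ ^ (3 / 2 : ℝ) ≤
        ENNReal.ofReal (L ^ (2 - 2 * ρ)) * (ENNReal.ofReal ((2 - 2 * ρ) / (2 + ρ)) * (c : ℝ≥0∞)))
    (hPoisson : ∀ θ : EuclideanSpace ℝ (Fin 3) → ℝ, ContDiff ℝ (⊤ : ℕ∞) θ → HasCompactSupport θ →
      ∫ y, P y * (Δ θ) y = -∫ y, fderiv ℝ (fderiv ℝ θ) y (V y) (V y))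
    (hEE : ∀ θ : EuclideanSpace ℝ (Fin 3) → ℝ, IsTestFunctionOn (⊤ : Opens (EuclideanSpace ℝ (Fin 3))) θ →
      (∀ z : EuclideanSpace ℝ (Fin 3), ∃ m : ℝ, gradient θ z = m • z) →
      (2 - 5 * (1 / (2 + ρ))) * ∫ x, θ x * ‖V x‖ ^ 2 =
        (∫ x, (‖V x‖ ^ 2 + 2 * P x) * ⟪V x, gradient θ x⟫) +
          (1 / (2 + ρ)) * ∫ x, ‖V x‖ ^ 2 * ⟪x, gradient θ x⟫)
    (hsub : ∀ ε : ℝ, 0 < ε → ∀ L₀ : ℝ, ∃ L : ℝ, L₀ ≤ L ∧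
      L ^ (2 * ρ - 1) * ∫ y in ball (0 : EuclideanSpace ℝ (Fin 3)) L, ‖V y‖ ^ 2 < ε) :
    V =ᵐ[volume] 0 := by
  have hc0 : (0 : ℝ) ≤ c := c.2
  have hV2 : LocallyIntegrable (fun y => ‖V y‖ ^ 2) volume := locallyIntegrable_norm_sq_of_growth_loc hVm hA
  -- the radial cut-off (its `k`-clause is KEPT: the rescaled cut-offs have radial gradient)
  obtain ⟨σ, hσs, hσc, h0, h1, hone, hzero, k, -, hk⟩ := exists_radialCutoff
  have hσ : IsTestFunctionOn (⊤ : Opens (EuclideanSpace ℝ (Fin 3))) σ := ⟨hσs, hσc, fun _ _ => trivial⟩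
  have hσd : Differentiable ℝ σ := hσs.differentiable (by simp)
  have hσrad : ∀ z : EuclideanSpace ℝ (Fin 3), ∃ m : ℝ, gradient σ z = m • z := hasRadialGradient_of_inner hk
  have hEEσ : ∀ L : ℝ, 0 < L → (2 - 5 * (1 / (2 + ρ))) * ∫ x, σ (L⁻¹ • x) * ‖V x‖ ^ 2 =
      (∫ x, (‖V x‖ ^ 2 + 2 * P x) * ⟪V x, gradient (fun z => σ (L⁻¹ • z)) x⟫) +
        (1 / (2 + ρ)) * ∫ x, ‖V x‖ ^ 2 * ⟪x, gradient (fun z => σ (L⁻¹ • z)) x⟫ :=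
    fun L hL => hEE _ (isTestFunctionOn_comp_inv_smul hσ hL.ne') (hasRadialGradient_comp_inv_smul hσd hσrad L)
  -- the normalised energy `N`
  set N : ℝ → ℝ := fun R => R ^ (2 * ρ - 1) * ∫ y, σ (R⁻¹ • y) * ‖V y‖ ^ 2 with hN
  have hN0 : ∀ R, 0 < R → 0 ≤ N R := fun R hR =>
    mul_nonneg (Real.rpow_nonneg hR.le _) (integral_nonneg fun y => mul_nonneg (h0 _) (sq_nonneg _))
  have hN3 : ∀ R, 1 ≤ R → N R ≤ 3 * c := by
    intro R hR
    have h := normEnergy_le_of_growth_loc (ρ := ρ) h0 h1 hzero hVm hA hR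
    have h3 : (3 : ℝ) ^ (1 - 2 * ρ) ≤ 3 := by
      conv_rhs => rw [← Real.rpow_one 3]
      exact Real.rpow_le_rpow_of_exponent_le (by norm_num) (by linarith)
    exact h.trans (by gcongr)
  -- the flux weight bound and the tail estimate
  obtain ⟨A, hA0, hflux⟩ := exists_fluxWeight_le_of_sup_loc hρ hρ1 hσ h0 h1 hone hzero hVm hPm hGm hVG hA hE hD
    hPoisson
  set a : ℝ := (2 + ρ) / 4 with hadef
  have ha0 : 0 < a := by rw [hadef]; positivity
  set B₀ : ℝ := A / a with hB₀
  have hB₀0 : 0 ≤ B₀ := div_nonneg hA0 ha0.le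
  -- admissible `S` on `[L, ∞)` ⇒ tail estimate
  have htail : ∀ L : ℝ, 1 ≤ L → ∀ S : ℝ, 0 ≤ S → S ≤ 3 * c → (∀ R, L ≤ R → N R ≤ S) →
      ∀ L₁ L₂ : ℝ, L ≤ L₁ → L₁ ≤ L₂ → |N L₂ - N L₁| ≤ B₀ * S ^ (1 / 2 : ℝ) * L₁ ^ (-a) := by
    intro L hL S hS hS3 hSsup L₁ L₂ hL₁ h12
    have hL0 : 0 < L := lt_of_lt_of_le one_pos hL
    have hsup' : ∀ R : ℝ, L ≤ R → ∫ y, σ (R⁻¹ • y) * ‖V y‖ ^ 2 ≤ R ^ (1 - 2 * ρ) * S := by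
      intro R hR
      have hR0 : 0 < R := lt_of_lt_of_le hL0 hR
      have h := hSsup R hR
      have hRR : R ^ (1 - 2 * ρ) * R ^ (2 * ρ - 1) = 1 := by rw [← Real.rpow_add hR0]; norm_num
      calc ∫ y, σ (R⁻¹ • y) * ‖V y‖ ^ 2 = R ^ (1 - 2 * ρ) * N R := by
            simp only [hN]; rw [← mul_assoc, hRR, one_mul]
        _ ≤ R ^ (1 - 2 * ρ) * S := mul_le_mul_of_nonneg_left h (Real.rpow_nonneg hR0.le _)
    have hfl := hflux S hS hS3 L hL hsup'
    have hfl' : ∀ r : ℝ, L ≤ r → |(2 + ρ) * r ^ (2 * ρ - 2) *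
        ∫ x, (‖V x‖ ^ 2 + 2 * P x) * ⟪V x, gradient (fun z => σ (r⁻¹ • z)) x⟫| ≤
        (A * S ^ (1 / 2 : ℝ)) * r ^ (-1 - a) := fun r hr => by rw [hadef]; exact hfl r hr
    have hAS : 0 ≤ A * S ^ (1 / 2 : ℝ) := by positivity
    have h := abs_normEnergy_sub_le_of_fluxWeight_le hρ hσ hVm hV2 hEEσ hAS ha0 hL0 hfl' hL₁ h12
    simp only [hN]
    calc |L₂ ^ (2 * ρ - 1) * (∫ y, σ (L₂⁻¹ • y) * ‖V y‖ ^ 2) -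
          L₁ ^ (2 * ρ - 1) * (∫ y, σ (L₁⁻¹ • y) * ‖V y‖ ^ 2)| ≤ A * S ^ (1 / 2 : ℝ) / a * L₁ ^ (-a) := h
      _ = B₀ * S ^ (1 / 2 : ℝ) * L₁ ^ (-a) := by rw [hB₀]; ring
  -- smallness at arbitrarily large scales: `N(L'/2) < 2ε`
  have hsmall : ∀ ε : ℝ, 0 < ε → ∀ R₀ : ℝ, 0 < R₀ → ∃ R' : ℝ, R₀ ≤ R' ∧ N R' < 2 * ε := by
    intro ε hε R₀ hR₀
    obtain ⟨L', hL', hlt⟩ := hsub ε hε (2 * R₀)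
    have hL'0 : 0 < L' := by linarith
    refine ⟨L' / 2, by linarith, ?_⟩
    have hB : IntegrableOn (fun y => ‖V y‖ ^ 2) (ball (0 : EuclideanSpace ℝ (Fin 3)) L') volume :=
      (memLp_two_iff_integrable_sq_norm hVm.restrict).1 (memLp_two_ball_of_growth_loc hVm hA _)
    -- `∫ σ(2y/L') |V|² ≤ ∫_{B_{L'}} |V|²`
    have hle : ∫ y, σ ((L' / 2)⁻¹ • y) * ‖V y‖ ^ 2 ≤ ∫ y in ball (0 : EuclideanSpace ℝ (Fin 3)) L', ‖V y‖ ^ 2 := by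
      rw [← integral_indicator measurableSet_ball]
      refine integral_mono_of_nonneg (Eventually.of_forall fun y => mul_nonneg (h0 _) (sq_nonneg _))
        (hB.integrable_indicator measurableSet_ball) (Eventually.of_forall fun y => ?_)
      by_cases hy : y ∈ ball (0 : EuclideanSpace ℝ (Fin 3)) L'
      · rw [indicator_of_mem hy]
        exact mul_le_of_le_one_left (sq_nonneg _) (h1 _)
      · rw [indicator_of_notMem hy]
        rw [mem_ball, dist_zero_right, not_lt] at hy
        have : σ ((L' / 2)⁻¹ • y) = 0 := by
          apply hzero
          rw [norm_smul, norm_inv, Real.norm_of_nonneg (by positivity), le_inv_mul_iff₀ (by positivity)]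
          linarith
        show σ ((L' / 2)⁻¹ • y) * ‖V y‖ ^ 2 ≤ 0
        rw [this, zero_mul]
    have hI0 : 0 ≤ ∫ y in ball (0 : EuclideanSpace ℝ (Fin 3)) L', ‖V y‖ ^ 2 :=
      setIntegral_nonneg measurableSet_ball fun y _ => sq_nonneg _
    have hpow : (L' / 2) ^ (2 * ρ - 1) ≤ 2 * L' ^ (2 * ρ - 1) := by
      rw [Real.div_rpow hL'0.le (by norm_num)]
      rw [div_le_iff₀ (Real.rpow_pos_of_pos two_pos _)]
      have h2 : (2 : ℝ) ^ (2 * ρ - 1) ≥ 2⁻¹ := by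
        rw [show (2 : ℝ)⁻¹ = 2 ^ (-1 : ℝ) by rw [Real.rpow_neg_one]]
        exact Real.rpow_le_rpow_of_exponent_le (by norm_num) (by linarith)
      nlinarith [Real.rpow_nonneg hL'0.le (2 * ρ - 1), h2]
    simp only [hN]
    calc (L' / 2) ^ (2 * ρ - 1) * ∫ y, σ ((L' / 2)⁻¹ • y) * ‖V y‖ ^ 2
        ≤ (2 * L' ^ (2 * ρ - 1)) * ∫ y in ball (0 : EuclideanSpace ℝ (Fin 3)) L', ‖V y‖ ^ 2 :=
          mul_le_mul hpow hle (integral_nonneg fun y => mul_nonneg (h0 _) (sq_nonneg _)) (by positivity)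
      _ = 2 * (L' ^ (2 * ρ - 1) * ∫ y in ball (0 : EuclideanSpace ℝ (Fin 3)) L', ‖V y‖ ^ 2) := by ring
      _ < 2 * ε := by linarith
  -- KEY CLAIM: an admissible `S` on `[L, ∞)` improves to `B₀ S^{1/2} L^{-a}`
  have hkey : ∀ L : ℝ, 1 ≤ L → ∀ S : ℝ, 0 ≤ S → S ≤ 3 * c → (∀ R, L ≤ R → N R ≤ S) →
      ∀ R, L ≤ R → N R ≤ B₀ * S ^ (1 / 2 : ℝ) * L ^ (-a) := by
    intro L hL S hS hS3 hSsup R hR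
    have hL0 : 0 < L := lt_of_lt_of_le one_pos hL
    have hR0 : 0 < R := lt_of_lt_of_le hL0 hR
    have hRa : R ^ (-a) ≤ L ^ (-a) := Real.rpow_le_rpow_of_nonpos hL0 hR (by linarith)
    refine le_of_forall_pos_lt_add fun ε hε => ?_
    obtain ⟨R', hRR', hsmallR'⟩ := hsmall (ε / 2) (by positivity) R hR0
    have ht := htail L hL S hS hS3 hSsup R R' hR hRR'
    have : N R ≤ N R' + B₀ * S ^ (1 / 2 : ℝ) * R ^ (-a) := by
      have := abs_sub_le_iff.1 ht
      linarith [this.2]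
    have hmono : B₀ * S ^ (1 / 2 : ℝ) * R ^ (-a) ≤ B₀ * S ^ (1 / 2 : ℝ) * L ^ (-a) :=
      mul_le_mul_of_nonneg_left hRa (by positivity)
    linarith
  -- ABSORPTION: the tail supremum on `[L, ∞)` is at most `B₀² L^{-2a}`
  have hdecay : ∀ L : ℝ, 1 ≤ L → N L ≤ B₀ ^ 2 * (L ^ (-a)) ^ 2 := by
    intro L hL
    have hL0 : 0 < L := lt_of_lt_of_le one_pos hL
    set T : Set ℝ := N '' Ici L with hT
    have hTne : T.Nonempty := ⟨N L, L, Set.self_mem_Ici, rfl⟩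
    have hTbdd : BddAbove T := ⟨3 * c, by
      rintro _ ⟨R, hR, rfl⟩; exact hN3 R (hL.trans (Set.mem_Ici.1 hR))⟩
    set S : ℝ := sSup T with hSdef
    have hSsup : ∀ R, L ≤ R → N R ≤ S := fun R hR => le_csSup hTbdd ⟨R, Set.mem_Ici.2 hR, rfl⟩
    have hS0 : 0 ≤ S := (hN0 L hL0).trans (hSsup L le_rfl)
    have hS3 : S ≤ 3 * c := csSup_le hTne (by
      rintro _ ⟨R, hR, rfl⟩; exact hN3 R (hL.trans (Set.mem_Ici.1 hR)))
    have hSle : S ≤ B₀ * S ^ (1 / 2 : ℝ) * L ^ (-a) :=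
      csSup_le hTne (by rintro _ ⟨R, hR, rfl⟩; exact hkey L hL S hS0 hS3 hSsup R (Set.mem_Ici.1 hR))
    have habs := le_sq_of_le_mul_sqrt hS0 hB₀0 (Real.rpow_nonneg hL0.le _) hSle
    exact (hSsup L le_rfl).trans habs
  -- CONCLUSION: the energy of every ball vanishes
  have hballzero : ∀ L₀ : ℝ, 0 < L₀ → ∫⁻ y in ball (0 : EuclideanSpace ℝ (Fin 3)) L₀, ‖V y‖ₑ ^ 2 = 0 := by
    intro L₀ hL₀
    refine le_antisymm (ENNReal.le_of_forall_pos_le_add fun δ hδ _ => ?_) zero_le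
    rw [zero_add]
    -- choose `L ≥ max L₀ 1` with `B₀² L^{1-2ρ-2a} < δ`
    have hexp : (1 - 2 * ρ) + -(2 * a) < 0 := by rw [hadef]; linarith
    have htend : Tendsto (fun L : ℝ => B₀ ^ 2 * L ^ ((1 - 2 * ρ) + -(2 * a))) atTop (𝓝 (B₀ ^ 2 * 0)) := by
      refine tendsto_const_nhds.mul ?_
      have := tendsto_rpow_neg_atTop (y := -((1 - 2 * ρ) + -(2 * a))) (by linarith)
      simpa using this
    rw [mul_zero] at htend
    have hev := (htend.eventually (gt_mem_nhds (show (0 : ℝ) < δ from hδ))).and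
      (eventually_ge_atTop (max L₀ 1))
    obtain ⟨L, hLδ, hLge⟩ := hev.exists
    have hL1 : 1 ≤ L := (le_max_right _ _).trans hLge
    have hL0 : 0 < L := lt_of_lt_of_le one_pos hL1
    have hLL₀ : L₀ ≤ L := (le_max_left _ _).trans hLge
    -- `∫_{B_{L₀}} ≤ ∫_{B_L} ≤ ofReal (∫ σ_L |V|²) ≤ ofReal (L^{1-2ρ} B₀² L^{-2a})`
    have h1 := lintegral_ball_sq_le_cutoffEnergy hσs.continuous hσc h0 hone hV2 hL0
    have hNL := hdecay L hL1
    have hI : ∫ y, σ (L⁻¹ • y) * ‖V y‖ ^ 2 ≤ B₀ ^ 2 * L ^ ((1 - 2 * ρ) + -(2 * a)) := by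
      have hRR : L ^ (1 - 2 * ρ) * L ^ (2 * ρ - 1) = 1 := by rw [← Real.rpow_add hL0]; norm_num
      have e2 : (L ^ (-a)) ^ 2 = L ^ (-(2 * a)) := by
        rw [← Real.rpow_natCast, ← Real.rpow_mul hL0.le]; norm_num; ring_nf
      calc ∫ y, σ (L⁻¹ • y) * ‖V y‖ ^ 2 = L ^ (1 - 2 * ρ) * N L := by
            simp only [hN]; rw [← mul_assoc, hRR, one_mul]
        _ ≤ L ^ (1 - 2 * ρ) * (B₀ ^ 2 * (L ^ (-a)) ^ 2) :=
            mul_le_mul_of_nonneg_left hNL (Real.rpow_nonneg hL0.le _)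
        _ = B₀ ^ 2 * (L ^ (1 - 2 * ρ) * L ^ (-(2 * a))) := by rw [e2]; ring
        _ = B₀ ^ 2 * L ^ ((1 - 2 * ρ) + -(2 * a)) := by rw [← Real.rpow_add hL0]
    calc ∫⁻ y in ball (0 : EuclideanSpace ℝ (Fin 3)) L₀, ‖V y‖ₑ ^ 2
        ≤ ∫⁻ y in ball (0 : EuclideanSpace ℝ (Fin 3)) L, ‖V y‖ₑ ^ 2 := lintegral_mono_set (ball_subset_ball hLL₀)
      _ ≤ ENNReal.ofReal (∫ y, σ (L⁻¹ • y) * ‖V y‖ ^ 2) := h1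
      _ ≤ ENNReal.ofReal (B₀ ^ 2 * L ^ ((1 - 2 * ρ) + -(2 * a))) := ENNReal.ofReal_le_ofReal hI
      _ ≤ (δ : ℝ≥0∞) := by
          rw [← ENNReal.ofReal_coe_nnreal]; exact ENNReal.ofReal_le_ofReal hLδ.le
  -- hence `V = 0` a.e.
  have hball_ae : ∀ n : ℕ, ∀ᵐ y ∂(volume.restrict (ball (0 : EuclideanSpace ℝ (Fin 3)) ((n : ℝ) + 1))), V y = 0 := by
    intro n
    have h := hballzero ((n : ℝ) + 1) (by positivity)
    rw [lintegral_eq_zero_iff' (hVm.restrict.enorm.pow_const 2)] at h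
    filter_upwards [h] with y hy
    simpa using hy
  have hunion : (⋃ n : ℕ, ball (0 : EuclideanSpace ℝ (Fin 3)) ((n : ℝ) + 1)) = univ := by
    refine eq_univ_of_forall fun y => mem_iUnion.2 ?_
    obtain ⟨n, hn⟩ := exists_nat_gt ‖y‖
    exact ⟨n, by rw [mem_ball, dist_zero_right]; linarith⟩
  have h := (ae_restrict_iUnion_iff (μ := (volume : Measure (EuclideanSpace ℝ (Fin 3))))
    (fun n : ℕ => ball (0 : EuclideanSpace ℝ (Fin 3)) ((n : ℝ) + 1)) (fun y => V y = 0)).2 hball_ae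
  rw [hunion, Measure.restrict_univ] at h
  exact h

/-- **A spiral member whose velocity profile vanishes a.e. is trivial** (crux hypotheses verbatim, any `ρ ≥ 0`): for every
`τ < T₁` the slice `u(τ) = (T−τ)^{γ−1} e^{sS} V(e^{−sS}(T−τ)^{−γ}(· − x₀))` vanishes a.e. — translated dilations are
quasi-measure-preserving (`Past.quasiMeasurePreserving_smul_sub`) and rotations `e^{−sS}` (`S` skew) preserve Lebesgue measure
(`Killing.measurePreserving_expSkew`) — so the past is energy-quiescent and the crux's filled stratum
`ae_eq_zero_of_gauge_of_energyVanishing_allRho` applies.  The spiral twin of `Past.ae_eq_zero_of_profile_ae_eq_zero`. [folklore] -/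
theorem ae_eq_zero_of_profile_ae_eq_zero_pastSpiral {ρ T T₁ : ℝ} {x₀ : EuclideanSpace ℝ (Fin 3)} {S : EuclideanSpace ℝ (Fin 3) →L[ℝ] EuclideanSpace ℝ (Fin 3)}
    {u : ℝ → EuclideanSpace ℝ (Fin 3) → EuclideanSpace ℝ (Fin 3)} {p : ℝ → EuclideanSpace ℝ (Fin 3) → ℝ} {H : ℝ → EuclideanSpace ℝ (Fin 3) → EuclideanSpace ℝ (Fin 3) →L[ℝ] EuclideanSpace ℝ (Fin 3)} {c : ℝ≥0} {V : EuclideanSpace ℝ (Fin 3) → EuclideanSpace ℝ (Fin 3)}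
    (hρ : 0 ≤ ρ) (hTT₁ : T₁ ≤ T)
    (hsw : IsSuitableWeakSolutionOn (slab (EuclideanSpace ℝ (Fin 3)) (Set.Iio 0) isOpen_Iio) 0 0 u p)
    (hH : HasWeakSpatialGradientOn (slab (EuclideanSpace ℝ (Fin 3)) (Set.Iio 0) isOpen_Iio) u H)
    (hgauge : ∀ a : ℝ, 0 < a →
      ENNReal.ofReal (a ^ (2 * ρ)) * cknA a (0 : ℝ × EuclideanSpace ℝ (Fin 3)) u + ENNReal.ofReal (a ^ ρ) * cknE a (0 : ℝ × EuclideanSpace ℝ (Fin 3)) H +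
        ENNReal.ofReal (a ^ (2 * ρ)) * cknD a (0 : ℝ × EuclideanSpace ℝ (Fin 3)) p ≤ (c : ℝ≥0∞))
    (hS : ∀ x y : EuclideanSpace ℝ (Fin 3), ⟪S x, y⟫ = -⟪x, S y⟫)
    (hu : ∀ τ : ℝ, τ < T₁ → u τ = fun x => (T - τ) ^ (1 / (2 + ρ) - 1) •
      NormedSpace.exp ((Real.log (T - τ)) • S)
        (V (NormedSpace.exp ((-Real.log (T - τ)) • S) ((T - τ) ^ (-(1 / (2 + ρ))) • (x - x₀)))))
    (hV0 : V =ᵐ[volume] 0) :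
    Function.uncurry u =ᵐ[volume.restrict (Set.Iio (0 : ℝ) ×ˢ (Set.univ : Set (EuclideanSpace ℝ (Fin 3))))] 0 := by
  have hSx : ∀ x : EuclideanSpace ℝ (Fin 3), ⟪S x, x⟫ = 0 := by
    intro x
    have h := hS x x
    have h' : ⟪S x, x⟫ = ⟪x, S x⟫ := real_inner_comm _ _
    linarith
  refine ae_eq_zero_of_gauge_of_energyVanishing_allRho hρ hsw hH hgauge fun ε hε N => ?_
  -- the energy vanishes identically for `s < min (−N) T₁`
  have hsub : Set.Iio (min (-N) T₁) ⊆ {s : ℝ | s < -N ∧ ∫⁻ x, ‖u s x‖ₑ ^ 2 ≤ ENNReal.ofReal ε} := by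
    intro s hs
    rw [Set.mem_Iio, lt_min_iff] at hs
    refine ⟨hs.1, ?_⟩
    have hsT : 0 < T - s := by linarith [hs.2]
    have hd : (T - s) ^ (-(1 / (2 + ρ))) ≠ 0 := (Real.rpow_pos_of_pos hsT _).ne'
    have hqmp : Measure.QuasiMeasurePreserving
        ((fun x : EuclideanSpace ℝ (Fin 3) => NormedSpace.exp ((-Real.log (T - s)) • S) x) ∘ fun x : EuclideanSpace ℝ (Fin 3) => (T - s) ^ (-(1 / (2 + ρ))) • (x - x₀))
        volume volume :=
      (Killing.measurePreserving_expSkew hSx (-Real.log (T - s))).quasiMeasurePreserving.comp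
        (Past.quasiMeasurePreserving_smul_sub hd x₀)
    have hae : (fun x => ‖u s x‖ₑ ^ 2) =ᵐ[volume] fun _ => 0 := by
      have h1 := hqmp.ae_eq_comp hV0
      filter_upwards [h1] with x hx
      simp only [comp_apply, Pi.zero_apply] at hx
      rw [hu s hs.2]
      simp only
      rw [hx, map_zero, smul_zero, enorm_zero, zero_pow two_ne_zero]
    rw [lintegral_congr_ae hae, lintegral_zero]
    exact zero_le
  have hinf : volume (Set.Iio (min (-N) T₁)) = (⊤ : ℝ≥0∞) := Real.volume_Iio
  intro h0
  have := measure_mono_null hsub h0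
  rw [hinf] at this
  exact ENNReal.top_ne_zero this

/-- **The sub-extremal SPIRAL member is trivial, MODULO THE SPIRAL DICTIONARY** (R3 from R3a of line `relative_equilibria`,
member level): crux hypotheses verbatim (`0 < ρ ≤ ½`), `u` a Perelman spiral about `(T, x₀)` with skew generator `S` and profile `V`
for `τ < T₁` (`T₁ ≤ T`), the large-scale profile data of the dictionary (a profile pressure `P`, a weak gradient `G`, one constant
`c'`, (A₁)/(E₁)/(D₁) for `L ≥ 1`, the weak pressure Poisson equation and the profile local energy identity for RADIAL-GRADIENT tests)
and `liminf_{L→∞} L^{2ρ−1}∫_{B_L}|V|² = 0` ⇒ `u = 0` a.e. on `(−∞,0) × ℝ³`.  The dictionary itself (`Sig.stub_spiralLocData`: bricks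
P2–P7 of the port recipe) is supplied by its own files; composing gives the LEAD's binder `¬ IsPastSpiralSubExtremal ρ u`.
Pattern: `Past.selfSimilar_ae_eq_zero_of_subExtremal_past`. [folklore; cf. BronziShvydkoy2015 Thm 1.1] -/
theorem pastSpiral_trivial_of_locData_of_subExtremal {ρ : ℝ} (hρ : 0 < ρ) (hρh : ρ ≤ 1 / 2)
    {T T₁ : ℝ} (hTT₁ : T₁ ≤ T) {x₀ : EuclideanSpace ℝ (Fin 3)} {S : EuclideanSpace ℝ (Fin 3) →L[ℝ] EuclideanSpace ℝ (Fin 3)}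
    {u : ℝ → EuclideanSpace ℝ (Fin 3) → EuclideanSpace ℝ (Fin 3)} {p : ℝ → EuclideanSpace ℝ (Fin 3) → ℝ} {H : ℝ → EuclideanSpace ℝ (Fin 3) → EuclideanSpace ℝ (Fin 3) →L[ℝ] EuclideanSpace ℝ (Fin 3)} {c : ℝ≥0} {V : EuclideanSpace ℝ (Fin 3) → EuclideanSpace ℝ (Fin 3)}
    (hsw : IsSuitableWeakSolutionOn (slab (EuclideanSpace ℝ (Fin 3)) (Set.Iio 0) isOpen_Iio) 0 0 u p)
    (hH : HasWeakSpatialGradientOn (slab (EuclideanSpace ℝ (Fin 3)) (Set.Iio 0) isOpen_Iio) u H)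
    (hgauge : ∀ a : ℝ, 0 < a →
      ENNReal.ofReal (a ^ (2 * ρ)) * cknA a (0 : ℝ × EuclideanSpace ℝ (Fin 3)) u + ENNReal.ofReal (a ^ ρ) * cknE a (0 : ℝ × EuclideanSpace ℝ (Fin 3)) H +
        ENNReal.ofReal (a ^ (2 * ρ)) * cknD a (0 : ℝ × EuclideanSpace ℝ (Fin 3)) p ≤ (c : ℝ≥0∞))
    (hS : ∀ x y : EuclideanSpace ℝ (Fin 3), ⟪S x, y⟫ = -⟪x, S y⟫)
    (hu : ∀ τ : ℝ, τ < T₁ → u τ = fun x => (T - τ) ^ (1 / (2 + ρ) - 1) •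
      NormedSpace.exp ((Real.log (T - τ)) • S)
        (V (NormedSpace.exp ((-Real.log (T - τ)) • S) ((T - τ) ^ (-(1 / (2 + ρ))) • (x - x₀)))))
    (hloc : ∃ (P : EuclideanSpace ℝ (Fin 3) → ℝ) (G : EuclideanSpace ℝ (Fin 3) → EuclideanSpace ℝ (Fin 3) →L[ℝ] EuclideanSpace ℝ (Fin 3)) (c' : ℝ≥0),
        AEStronglyMeasurable V volume ∧ AEStronglyMeasurable P volume ∧ AEStronglyMeasurable G volume ∧
        HasWeakFDerivOn (⊤ : TopologicalSpace.Opens (EuclideanSpace ℝ (Fin 3))) volume V G ∧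
        (∀ L : ℝ, 1 ≤ L → ∫⁻ y in Metric.ball (0 : EuclideanSpace ℝ (Fin 3)) L, ‖V y‖ₑ ^ 2 ≤
          (c' : ℝ≥0∞) * ENNReal.ofReal (L ^ (1 - 2 * ρ))) ∧
        (∀ L : ℝ, 1 ≤ L →
          ∫⁻ y in Metric.ball (0 : EuclideanSpace ℝ (Fin 3)) L, ENNReal.ofReal (frobeniusNormSq (G y)) ≤
            ENNReal.ofReal (L ^ (1 - ρ)) * (ENNReal.ofReal ((1 - ρ) / (2 + ρ)) * (c' : ℝ≥0∞))) ∧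
        (∀ L : ℝ, 1 ≤ L →
          ∫⁻ y in Metric.ball (0 : EuclideanSpace ℝ (Fin 3)) L, ‖P y‖ₑ ^ (3 / 2 : ℝ) ≤
            ENNReal.ofReal (L ^ (2 - 2 * ρ)) * (ENNReal.ofReal ((2 - 2 * ρ) / (2 + ρ)) * (c' : ℝ≥0∞))) ∧
        (∀ θ : EuclideanSpace ℝ (Fin 3) → ℝ, ContDiff ℝ (⊤ : ℕ∞) θ → HasCompactSupport θ →
          ∫ y, P y * (Δ θ) y = -∫ y, fderiv ℝ (fderiv ℝ θ) y (V y) (V y)) ∧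
        (∀ θ : EuclideanSpace ℝ (Fin 3) → ℝ, IsTestFunctionOn (⊤ : TopologicalSpace.Opens (EuclideanSpace ℝ (Fin 3))) θ → (∀ z : EuclideanSpace ℝ (Fin 3), ∃ m : ℝ, gradient θ z = m • z) →
          (2 - 5 * (1 / (2 + ρ))) * ∫ x, θ x * ‖V x‖ ^ 2 =
            (∫ x, (‖V x‖ ^ 2 + 2 * P x) * ⟪V x, gradient θ x⟫) +
              (1 / (2 + ρ)) * ∫ x, ‖V x‖ ^ 2 * ⟪x, gradient θ x⟫))
    (hsub : ∀ ε : ℝ, 0 < ε → ∀ L₀ : ℝ, ∃ L : ℝ, L₀ ≤ L ∧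
      L ^ (2 * ρ - 1) * ∫ y in Metric.ball (0 : EuclideanSpace ℝ (Fin 3)) L, ‖V y‖ ^ 2 < ε) :
    Function.uncurry u =ᵐ[volume.restrict (Set.Iio (0 : ℝ) ×ˢ (Set.univ : Set (EuclideanSpace ℝ (Fin 3))))] 0 := by
  have hρ1 : ρ < 1 := by linarith
  obtain ⟨P, G, c', hVm, hPm, hGm, hVG, hA₁, hE₁, hD₁, hPoisson, hEE⟩ := hloc
  have hV0 : V =ᵐ[volume] 0 :=
    ae_eq_zero_of_subExtremal_loc_radial hρ hρ1 hVm hPm hGm hVG hA₁ hE₁ hD₁ hPoisson hEE hsub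
  exact ae_eq_zero_of_profile_ae_eq_zero_pastSpiral hρ.le hTT₁ hsw hH hgauge hS hu hV0

end Spiral

end Summit.NavierStokesRegularity.NavierStokesRegularity.Theorems.PowerGaugeEulerLiouville
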